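import Summits.Schanuel.Schanuel.Theorems.SoloInformedRoyWindow
import Summits.Schanuel.Schanuel.Theorems.SoloInformedRoySinglePointBox
import Summits.Schanuel.Schanuel.Theorems.SoloInformedRoyTranslateGrowth
import Literature.NumberTheory.Transcendental.RoyCriterionProp2Proofs
import Literature.NumberTheory.Transcendental.RoyCriterionProp3Proofs
import Literature.NumberTheory.Transcendental.RoyCriterionThm3Proofs
import HarnessLib

/-!
# Roy's criterion is sharp to within `ε` in the translate exponent

(solo seat `solo-Schanuel-informed`, session 4; sequel to `SoloInformedRoySinglePointBox`.)

Roy's Theorem 1 [Roy2001]: for `α ≠ 0` and `(s₀, s₁, t₀, t₁, u)` in the window (1), condition (b) —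
for all large `N` some `Q_N ≠ 0` with `deg Q_N ≤ (N^{t₀}, N^{t₁})`, `H(Q_N) ≤ e^N` has
`|(D^k Q_N)(my, α^m)| ≤ e^{-N^u}` for all `k ≤ N^{s₀}`, `m ≤ N^{s₁}` — holds iff `(y, α)` lies on
the graph of `exp` up to torsion.  `SoloInformedRoySinglePointBox` showed that the
single-translate (`m = 1`) part of (b) holds at every point of `ℂ²`.  Here we locate the content
of the criterion more precisely:

* `royConditionB_of_lt` — Dirichlet's box principle gives condition (b) at EVERY `(y, α) ∈ ℂ²` as
  soon as the translate exponent `s₁` satisfies `s₀ + s₁ + u < 1 + t₀ + t₁` (precision),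
  `s₀ + 2 s₁ + t₁ < 1 + t₀ + t₁` (growth of `α^m`), `2 s₀ + s₁ < 1 + t₀ + t₁` (the `k!`),
  `s₀ + s₁ + t₀ < 1 + t₀ + t₁` (growth of `(my)^a`), with `1 ≤ u`;
* `roy_criterion_sharp_in_translate_exponent` — consequently, for every `ε > 0` there are
  admissible parameters (`t₀ = 1 - η`, `t₁ = ½ - η`, `s₀ = 1 + η`, `s₁ = ½ + η`, `u = 1 + 2η`,
  `η = min(ε, ½)/13`) for which Roy's Theorem 1 holds with translate exponent `s₁` while condition
  (b) with translate exponent `s₁ - ε` holds at every point of `ℂ²`: in this corner of the window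
  the whole arithmetic content of the criterion (graph of `exp` versus the rest of `ℂ × ℂˣ`) sits
  in the translates `N^{s₁-ε} < m ≤ N^{s₁}`.

Window (1) forces `1 + t₀ + t₁ < s₀ + s₁ + u` (`royAdmissible_one_add_lt`), i.e. Roy's `s₁`
always exceeds the Dirichlet-trivial range — as it must, (b) ⇒ (a) being a theorem.

## Proof

As in `SoloInformedRoySinglePointBox` (box principle `exists_ne_zero_int_forms_le` on the real and
imaginary parts of the values, Cauchy bounds `norm_aeval_iterate_royD_monoXY_le` for the monomial
coefficients), now with the `2(K+1)(M₁+1)` forms indexed by `k ≤ K = ⌊N^{s₀}⌋`, `m ≤ M₁ = ⌊N^{s₁}⌋`;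
at `(my, α^m)` the coefficients are bounded by `K! ((1+M₁)(1+|y|))^{T₀} (2e(1+|α|)^{M₁})^{T₁}`.
-/

noncomputable section

open MvPolynomial Filter Complex Metric
open Literature.NumberTheory.Transcendental

namespace Summit.Schanuel.Schanuel.Theorems

/-! ### Cauchy bound at the translates -/

/-- Cauchy bound at the translate `(my, α^m)`, uniform over `k ≤ K`, `m ≤ M₁`, `a ≤ T₀`,
`b ≤ T₁`. [folklore] -/
theorem norm_aeval_iterate_royD_monoXY_translate_le {k m K M₁ T₀ T₁ a b : ℕ} (hk : k ≤ K)
    (hm : m ≤ M₁) (ha : a ≤ T₀) (hb : b ≤ T₁) (y α : ℂ) :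
    ‖aeval ![(m : ℂ) * y, α ^ m] (royD^[k] (monoXY a b))‖ ≤ K.factorial *
      (((1 + M₁) * (1 + ‖y‖)) ^ T₀ * (2 * (Real.exp 1 * (1 + ‖α‖) ^ M₁)) ^ T₁) := by
  have h1y : (1 : ℝ) ≤ 1 + ‖y‖ := by linarith [norm_nonneg y]
  have h1α : (1 : ℝ) ≤ 1 + ‖α‖ := by linarith [norm_nonneg α]
  have hb₀ : (1 : ℝ) ≤ (1 + M₁) * (1 + ‖y‖) :=
    one_le_mul_of_one_le_of_one_le (by linarith [(Nat.cast_nonneg M₁ : (0 : ℝ) ≤ M₁)]) h1y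
  have hb₁ : (1 : ℝ) ≤ 2 * (Real.exp 1 * (1 + ‖α‖) ^ M₁) := by
    have := one_le_mul_of_one_le_of_one_le (Real.one_le_exp zero_le_one)
      (one_le_pow₀ h1α (n := M₁))
    linarith
  have hfact : (k.factorial : ℝ) ≤ K.factorial := by exact_mod_cast Nat.factorial_le hk
  have hmR : (m : ℝ) ≤ M₁ := by exact_mod_cast hm
  have hy' : 1 + ‖(m : ℂ) * y‖ ≤ (1 + M₁) * (1 + ‖y‖) := by
    rw [norm_mul, Complex.norm_natCast]
    have e : (1 + (M₁ : ℝ)) * (1 + ‖y‖) = 1 + ‖y‖ + M₁ + M₁ * ‖y‖ := by ring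
    have : (m : ℝ) * ‖y‖ ≤ M₁ * ‖y‖ := mul_le_mul_of_nonneg_right hmR (norm_nonneg y)
    linarith [norm_nonneg y, (Nat.cast_nonneg M₁ : (0 : ℝ) ≤ M₁)]
  have hα' : Real.exp 1 * (1 + ‖α ^ m‖) ≤ 2 * (Real.exp 1 * (1 + ‖α‖) ^ M₁) := by
    rw [norm_pow]
    have h1 : ‖α‖ ^ m ≤ (1 + ‖α‖) ^ M₁ :=
      (pow_le_pow_left₀ (norm_nonneg α) (by linarith) m).trans (pow_le_pow_right₀ h1α hm)
    have h2 : (1 : ℝ) ≤ (1 + ‖α‖) ^ M₁ := one_le_pow₀ h1α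
    calc Real.exp 1 * (1 + ‖α‖ ^ m) ≤ Real.exp 1 * (2 * (1 + ‖α‖) ^ M₁) :=
          mul_le_mul_of_nonneg_left (by linarith) (Real.exp_pos 1).le
      _ = 2 * (Real.exp 1 * (1 + ‖α‖) ^ M₁) := by ring
  refine (norm_aeval_iterate_royD_monoXY_le k _ _ _ _).trans (mul_le_mul hfact ?_
    (by positivity) (by positivity))
  exact mul_le_mul ((pow_le_pow_left₀ (by positivity) hy' _).trans (pow_le_pow_right₀ hb₀ ha))
    ((pow_le_pow_left₀ (by positivity) hα' _).trans (pow_le_pow_right₀ hb₁ hb))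
    (by positivity) (by positivity)

/-! ### Condition (b) below the Dirichlet threshold -/

/-- **Condition (b) is free below the Dirichlet threshold.** For every `(y, α) ∈ ℂ²`, Roy's
condition (b) with parameters `(s₀, s₁, t₀, t₁, u)` holds whenever `1 ≤ u`,
`s₀ + s₁ + u < 1 + t₀ + t₁`, `2 s₀ + s₁ < 1 + t₀ + t₁`, `s₀ + s₁ + t₀ < 1 + t₀ + t₁` and
`s₀ + 2 s₁ + t₁ < 1 + t₀ + t₁` (no hypothesis on `(y, α)`).
[folklore: Dirichlet's box principle, cf. Waldschmidt1981, Lemme 3.3; Roy2001, Thm. 1] -/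
theorem royConditionB_of_lt (y α : ℂ) {s₀ s₁ t₀ t₁ u : ℝ} (ht₀ : 0 < t₀) (ht₁ : 0 < t₁)
    (hs₀ : 0 < s₀) (hs₁ : 0 ≤ s₁) (hu : 1 ≤ u) (H1 : s₀ + s₁ + u < 1 + t₀ + t₁)
    (H3 : 2 * s₀ + s₁ < 1 + t₀ + t₁) (H4 : s₀ + s₁ + t₀ < 1 + t₀ + t₁)
    (H5 : s₀ + 2 * s₁ + t₁ < 1 + t₀ + t₁) : RoyConditionB y α s₀ s₁ t₀ t₁ u := by
  have h1y : (1 : ℝ) ≤ 1 + ‖y‖ := by linarith [norm_nonneg y]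
  have h1α : (1 : ℝ) ≤ 1 + ‖α‖ := by linarith [norm_nonneg α]
  set ε₀ : ℝ := (1 + t₀ + t₁ - 2 * s₀ - s₁) / 2 with hε₀
  set ε₁ : ℝ := (1 + t₀ + t₁ - s₀ - s₁ - t₀) / 2 with hε₁
  have hε₀0 : 0 < ε₀ := by rw [hε₀]; linarith
  have hε₁0 : 0 < ε₁ := by rw [hε₁]; linarith
  have hnum := eventually_translates_numerics hs₁ hu H1 (show 2 * s₀ + s₁ + ε₀ < 1 + t₀ + t₁ by
    rw [hε₀]; linarith) H4 (show s₀ + s₁ + t₀ + ε₁ < 1 + t₀ + t₁ by rw [hε₁]; linarith) H5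
    (Real.log (1 + ‖y‖)) (Real.log (1 + ‖α‖))
  unfold RoyConditionB
  filter_upwards [tendsto_natCast_atTop_atTop.eventually hnum] with N hN
  obtain ⟨hx1, hmain⟩ := hN
  set x : ℝ := (N : ℝ) with hxdef
  have hx0 : 0 < x := one_pos.trans_le hx1
  set T₀ : ℕ := ⌊x ^ t₀⌋₊ with hT₀
  set T₁ : ℕ := ⌊x ^ t₁⌋₊ with hT₁
  set K : ℕ := ⌊x ^ s₀⌋₊ with hK
  set M₁ : ℕ := ⌊x ^ s₁⌋₊ with hM₁
  set X : ℕ := ⌊Real.exp x⌋₊ with hX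
  have hT₀le : (T₀ : ℝ) ≤ x ^ t₀ := Nat.floor_le (Real.rpow_nonneg hx0.le _)
  have hT₁le : (T₁ : ℝ) ≤ x ^ t₁ := Nat.floor_le (Real.rpow_nonneg hx0.le _)
  have hKle : (K : ℝ) ≤ x ^ s₀ := Nat.floor_le (Real.rpow_nonneg hx0.le _)
  have hM₁le : (M₁ : ℝ) ≤ x ^ s₁ := Nat.floor_le (Real.rpow_nonneg hx0.le _)
  have hT₀lt : x ^ t₀ ≤ (T₀ : ℝ) + 1 := (Nat.lt_floor_add_one _).le
  have hT₁lt : x ^ t₁ ≤ (T₁ : ℝ) + 1 := (Nat.lt_floor_add_one _).le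
  have hXle : (X : ℝ) ≤ Real.exp x := Nat.floor_le (Real.exp_pos x).le
  have hXlt : Real.exp x < (X : ℝ) + 1 := Nat.lt_floor_add_one _
  have hX1R : (1 : ℝ) ≤ X := by exact_mod_cast Nat.floor_pos.2 (Real.one_le_exp hx0.le)
  have h1s₀ : (1 : ℝ) ≤ x ^ s₀ := Real.one_le_rpow hx1 hs₀.le
  have h1s₁ : (1 : ℝ) ≤ x ^ s₁ := Real.one_le_rpow hx1 hs₁
  -- the uniform coefficient bound `G` and the number of boxes per form `B`
  set G : ℝ := ((1 + M₁) * (1 + ‖y‖)) ^ T₀ * (2 * (Real.exp 1 * (1 + ‖α‖) ^ M₁)) ^ T₁ with hG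
  have hG1 : 1 ≤ G := by
    have hb₁ : (1 : ℝ) ≤ 2 * (Real.exp 1 * (1 + ‖α‖) ^ M₁) := by
      have := one_le_mul_of_one_le_of_one_le (Real.one_le_exp zero_le_one)
        (one_le_pow₀ h1α (n := M₁))
      linarith
    exact one_le_mul_of_one_le_of_one_le (one_le_pow₀ (one_le_mul_of_one_le_of_one_le
      (by linarith [(Nat.cast_nonneg M₁ : (0 : ℝ) ≤ M₁)]) h1y)) (one_le_pow₀ hb₁)
  have hG0 : 0 < G := one_pos.trans_le hG1
  set B : ℝ := 2 * X * (((T₀ + 1) * (T₁ + 1) : ℕ) : ℝ) * K.factorial * G * Real.exp (x ^ u)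
    with hB
  have hM1 : (1 : ℝ) ≤ (((T₀ + 1) * (T₁ + 1) : ℕ) : ℝ) := by
    exact_mod_cast Nat.one_le_iff_ne_zero.2 (by positivity)
  have hKf1 : (1 : ℝ) ≤ (K.factorial : ℝ) := by
    exact_mod_cast Nat.one_le_iff_ne_zero.2 (Nat.factorial_ne_zero K)
  have hE1 : (1 : ℝ) ≤ Real.exp (x ^ u) := Real.one_le_exp (Real.rpow_nonneg hx0.le _)
  have hB2 : (2 : ℝ) ≤ B := by
    rw [hB]
    calc (2 : ℝ) = 2 * 1 * 1 * 1 * 1 * 1 := by norm_num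
      _ ≤ 2 * X * (((T₀ + 1) * (T₁ + 1) : ℕ) : ℝ) * K.factorial * G * Real.exp (x ^ u) := by
          gcongr
  have hB0 : 0 < B := by linarith
  set ℓ : ℕ := ⌈B⌉₊ with hℓ
  have hℓpos : 0 < ℓ := Nat.ceil_pos.2 hB0
  have hℓposR : (0 : ℝ) < ℓ := by exact_mod_cast hℓpos
  have hBℓ : B ≤ ℓ := Nat.le_ceil B
  have hℓ2B : (ℓ : ℝ) ≤ 2 * B := by
    have := Nat.ceil_lt_add_one hB0.le
    rw [← hℓ] at this
    linarith
  -- `log ℓ` is small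
  have hGexp : G ≤ Real.exp ((Real.log 2 + Real.log (1 + ‖y‖)) * x ^ t₀ +
      s₁ / ε₁ * x ^ (t₀ + ε₁) + ((Real.log 2 + 1) * x ^ t₁ +
      Real.log (1 + ‖α‖) * x ^ (t₁ + s₁))) := by
    rw [hG]; exact translate_coeff_bound_le_exp hx1 hs₁ hε₁0 hT₀le hT₁le hM₁le y α
  have h4 : (4 : ℝ) ≤ Real.exp (Real.log 4) := by rw [Real.exp_log (by norm_num)]
  have hℓexp : (ℓ : ℝ) ≤ Real.exp (2 * Real.log 4 + (1 + t₀ + t₁) * x +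
      s₀ / ε₀ * x ^ (s₀ + ε₀) + (Real.log 2 + Real.log (1 + ‖y‖)) * x ^ t₀ +
      s₁ / ε₁ * x ^ (t₀ + ε₁) + (Real.log 2 + 1) * x ^ t₁ +
      Real.log (1 + ‖α‖) * x ^ (t₁ + s₁) + x ^ u) := by
    calc (ℓ : ℝ) ≤ 2 * B := hℓ2B
      _ = 4 * X * (((T₀ + 1) * (T₁ + 1) : ℕ) : ℝ) * K.factorial * G * Real.exp (x ^ u) := by
          rw [hB]; ring
      _ ≤ Real.exp (Real.log 4) * Real.exp x * Real.exp (Real.log 4 + (t₀ + t₁) * x) *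
          Real.exp (s₀ / ε₀ * x ^ (s₀ + ε₀)) *
          Real.exp ((Real.log 2 + Real.log (1 + ‖y‖)) * x ^ t₀ + s₁ / ε₁ * x ^ (t₀ + ε₁) +
            ((Real.log 2 + 1) * x ^ t₁ + Real.log (1 + ‖α‖) * x ^ (t₁ + s₁))) *
          Real.exp (x ^ u) :=
          mul_le_mul (mul_le_mul (mul_le_mul (mul_le_mul (mul_le_mul h4 hXle (by positivity)
            (by positivity)) (card_monomials_le_exp hx1 ht₀.le ht₁.le hT₀le hT₁le)
            (by positivity) (by positivity)) (factorial_le_exp_rpow hx1 hs₀ hε₀0 hKle)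
            (by positivity) (by positivity)) hGexp hG0.le (by positivity)) le_rfl
            (by positivity) (by positivity)
      _ = _ := by simp only [← Real.exp_add]; congr 1; ring
  have hlogℓ := (Real.log_le_log hℓposR hℓexp).trans_eq (Real.log_exp _)
  have hlogℓ0 : 0 ≤ Real.log ℓ := Real.log_nonneg (by exact_mod_cast hℓpos)
  -- the pigeon-hole count `ℓ^{2(K+1)(M₁+1)} < (X+1)^{(T₀+1)(T₁+1)}`
  have hK8 : (((K + 1) * (M₁ + 1) * 2 : ℕ) : ℝ) ≤ 8 * x ^ (s₀ + s₁) := by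
    rw [Real.rpow_add hx0]; push_cast
    have a1 : (K : ℝ) + 1 ≤ 2 * x ^ s₀ := by linarith
    have a2 : (M₁ : ℝ) + 1 ≤ 2 * x ^ s₁ := by linarith
    calc ((K : ℝ) + 1) * ((M₁ : ℝ) + 1) * 2 ≤ (2 * x ^ s₀) * (2 * x ^ s₁) * 2 := by
          gcongr
      _ = 8 * (x ^ s₀ * x ^ s₁) := by ring
  have hlhs : (((K + 1) * (M₁ + 1) * 2 : ℕ) : ℝ) * Real.log ℓ < x ^ (1 + t₀ + t₁) := by
    calc (((K + 1) * (M₁ + 1) * 2 : ℕ) : ℝ) * Real.log ℓ ≤ 8 * x ^ (s₀ + s₁) * Real.log ℓ :=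
          mul_le_mul_of_nonneg_right hK8 hlogℓ0
      _ ≤ _ := mul_le_mul_of_nonneg_left hlogℓ (by positivity)
      _ < x ^ (1 + t₀ + t₁) := hmain
  have hrhs : x ^ (1 + t₀ + t₁) ≤ (((T₀ + 1) * (T₁ + 1) : ℕ) : ℝ) * Real.log ((X : ℝ) + 1) := by
    have hMge : x ^ (t₀ + t₁) ≤ (((T₀ + 1) * (T₁ + 1) : ℕ) : ℝ) := by
      rw [Real.rpow_add hx0]; push_cast
      exact mul_le_mul hT₀lt hT₁lt (Real.rpow_nonneg hx0.le _) (by positivity)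
    have hlogX1 : x ≤ Real.log ((X : ℝ) + 1) := by
      rw [Real.le_log_iff_exp_le (by positivity)]; exact hXlt.le
    calc x ^ (1 + t₀ + t₁) = x ^ (t₀ + t₁) * x := by
          rw [show (1 + t₀ + t₁ : ℝ) = (t₀ + t₁) + 1 by ring, Real.rpow_add hx0, Real.rpow_one]
      _ ≤ (((T₀ + 1) * (T₁ + 1) : ℕ) : ℝ) * Real.log ((X : ℝ) + 1) :=
          mul_le_mul hMge hlogX1 hx0.le (by positivity)
  have hcardR : (ℓ : ℝ) ^ ((K + 1) * (M₁ + 1) * 2) < ((X : ℝ) + 1) ^ ((T₀ + 1) * (T₁ + 1)) := by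
    rw [← Real.exp_log hℓposR, ← Real.exp_log (by positivity : (0 : ℝ) < (X : ℝ) + 1),
      ← Real.exp_nat_mul, ← Real.exp_nat_mul]
    exact Real.exp_lt_exp.2 (hlhs.trans_le hrhs)
  have hcard : ℓ ^ ((K + 1) * (M₁ + 1) * 2) < (X + 1) ^ ((T₀ + 1) * (T₁ + 1)) := by
    exact_mod_cast hcardR
  -- the real linear forms: real and imaginary parts of `t ↦ (D^k Q_t)(my, α^m)`
  set c : ℕ → ℕ → Fin (T₀ + 1) × Fin (T₁ + 1) → ℂ :=
    fun k m ab => aeval ![(m : ℂ) * y, α ^ m] (royD^[k] (monoXY ab.1 ab.2)) with hc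
  set uu : (Fin (K + 1) × Fin (M₁ + 1)) × Fin 2 → Fin (T₀ + 1) × Fin (T₁ + 1) → ℝ :=
    fun kmj ab => if kmj.2 = 0 then (c kmj.1.1 kmj.1.2 ab).re else (c kmj.1.1 kmj.1.2 ab).im
    with huu
  obtain ⟨t, ht0, htX, hforms⟩ := exists_ne_zero_int_forms_le uu X ℓ hℓpos
    (by simpa [Fintype.card_prod, Fintype.card_fin] using hcard)
  have hA : ∀ (k : Fin (K + 1)) (m : Fin (M₁ + 1)) (j : Fin 2), ∑ ab, |uu ((k, m), j) ab| ≤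
      (((T₀ + 1) * (T₁ + 1) : ℕ) : ℝ) * (K.factorial * G) := by
    intro k m j
    have hk : (k : ℕ) ≤ K := Nat.lt_succ_iff.1 k.isLt
    have hm : (m : ℕ) ≤ M₁ := Nat.lt_succ_iff.1 m.isLt
    calc ∑ ab, |uu ((k, m), j) ab| ≤ ∑ ab, ‖c k m ab‖ := Finset.sum_le_sum fun ab _ => by
          fin_cases j
          · simpa [huu] using abs_re_le_norm (c k m ab)
          · simpa [huu] using abs_im_le_norm (c k m ab)
      _ ≤ ∑ _ab : Fin (T₀ + 1) × Fin (T₁ + 1), (K.factorial : ℝ) * G :=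
          Finset.sum_le_sum fun ab _ => by
            rw [hG]
            exact norm_aeval_iterate_royD_monoXY_translate_le hk hm
              (Nat.lt_succ_iff.1 ab.1.isLt) (Nat.lt_succ_iff.1 ab.2.isLt) y α
      _ = _ := by simp [Finset.sum_const, Finset.card_univ, Fintype.card_prod, Fintype.card_fin]
  -- the witness
  have htnorm : ‖t‖ ≤ (X : ℝ) := by
    refine (pi_norm_le_iff_of_nonneg (Nat.cast_nonneg X)).2 fun ab => ?_
    rw [Int.norm_eq_abs, ← Int.cast_abs]
    exact_mod_cast htX ab
  refine ⟨polyOfCoeffs t, polyOfCoeffs_ne_zero ht0, ?_, ?_, ?_, ?_⟩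
  · calc ((polyOfCoeffs t).degreeOf 0 : ℝ) ≤ (T₀ : ℝ) := by
          exact_mod_cast degreeOf_polyOfCoeffs_fst t
      _ ≤ x ^ t₀ := hT₀le
  · calc ((polyOfCoeffs t).degreeOf 1 : ℝ) ≤ (T₁ : ℝ) := by
          exact_mod_cast degreeOf_polyOfCoeffs_snd t
      _ ≤ x ^ t₁ := hT₁le
  · exact (mvPolyHeight_polyOfCoeffs_le t).trans (htnorm.trans hXle)
  · intro k m hk hm
    have hkK' : k < K + 1 := Nat.lt_succ_of_le (Nat.le_floor hk)
    have hmM' : m < M₁ + 1 := Nat.lt_succ_of_le (Nat.le_floor hm)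
    set kk : Fin (K + 1) := ⟨k, hkK'⟩ with hkk
    set mm : Fin (M₁ + 1) := ⟨m, hmM'⟩ with hmm
    have hv : aeval ![(m : ℂ) * y, α ^ m] (royD^[k] (polyOfCoeffs t)) =
        ∑ ab, (t ab : ℂ) * c k m ab := by
      rw [aeval_iterate_royD_polyOfCoeffs]
    have hre : (∑ ab, (t ab : ℂ) * c k m ab).re = ∑ ab, uu ((kk, mm), 0) ab * t ab := by
      rw [Complex.re_sum]
      refine Finset.sum_congr rfl fun ab _ => ?_
      simp [huu, hkk, hmm, Complex.mul_re, mul_comm]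
    have him : (∑ ab, (t ab : ℂ) * c k m ab).im = ∑ ab, uu ((kk, mm), 1) ab * t ab := by
      rw [Complex.im_sum]
      refine Finset.sum_congr rfl fun ab _ => ?_
      simp [huu, hkk, hmm, Complex.mul_im, mul_comm]
    set G' : ℝ := (((T₀ + 1) * (T₁ + 1) : ℕ) : ℝ) * (K.factorial * G) with hG'
    have hform : ∀ j : Fin 2, |∑ ab, uu ((kk, mm), j) ab * t ab| ≤ (X : ℝ) * G' / ℓ := fun j =>
      (hforms ((kk, mm), j)).trans (div_le_div_of_nonneg_right
        (mul_le_mul_of_nonneg_left (hA kk mm j) (Nat.cast_nonneg X)) hℓposR.le)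
    have hsmall : 2 * ((X : ℝ) * G' / ℓ) ≤ Real.exp (-x ^ u) := by
      have hBG : 2 * ((X : ℝ) * G') = B * Real.exp (-x ^ u) := by
        rw [hB, hG', Real.exp_neg]; field_simp
      rw [show 2 * ((X : ℝ) * G' / ℓ) = 2 * ((X : ℝ) * G') / ℓ by ring, hBG,
        div_le_iff₀ hℓposR]
      exact mul_comm (Real.exp (-x ^ u)) ℓ ▸
        mul_le_mul_of_nonneg_right hBℓ (Real.exp_pos _).le
    calc ‖aeval ![(m : ℂ) * y, α ^ m] (royD^[k] (polyOfCoeffs t))‖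
        ≤ |(aeval ![(m : ℂ) * y, α ^ m] (royD^[k] (polyOfCoeffs t))).re| +
          |(aeval ![(m : ℂ) * y, α ^ m] (royD^[k] (polyOfCoeffs t))).im| :=
          norm_le_abs_re_add_abs_im _
      _ = |∑ ab, uu ((kk, mm), 0) ab * t ab| + |∑ ab, uu ((kk, mm), 1) ab * t ab| := by
          rw [hv, hre, him]
      _ ≤ (X : ℝ) * G' / ℓ + (X : ℝ) * G' / ℓ := add_le_add (hform 0) (hform 1)
      _ = 2 * ((X : ℝ) * G' / ℓ) := by ring
      _ ≤ Real.exp (-x ^ u) := hsmall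

/-! ### Sharpness of Roy's Theorem 1 in the translate exponent -/

/-- Condition (b) is antitone in the translate exponent: fewer translates is a weaker condition.
[cite: Roy2001, Thm. 1 (b)] -/
theorem royConditionB_mono (y α : ℂ) {s₀ s₁ s₁' t₀ t₁ u : ℝ} (hs : s₁' ≤ s₁)
    (h : RoyConditionB y α s₀ s₁ t₀ t₁ u) : RoyConditionB y α s₀ s₁' t₀ t₁ u := by
  unfold RoyConditionB at h ⊢
  filter_upwards [h, eventually_ge_atTop 1] with N hN hN1
  obtain ⟨Q, hQ0, hd0, hd1, hH, hsmall⟩ := hN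
  refine ⟨Q, hQ0, hd0, hd1, hH, fun k m hk hm => hsmall k m hk (hm.trans ?_)⟩
  exact Real.rpow_le_rpow_of_exponent_le (by exact_mod_cast hN1) hs

/-- **Roy's criterion is sharp to within `ε` in the translate exponent.** For every `ε > 0` there
are admissible parameters `(s₀, s₁, t₀, t₁, u)` (so Roy's Theorem 1 holds: (b) ⟺ (a) for every
`(y, α) ∈ ℂ × ℂˣ`) for which condition (b) with `s₁` replaced by `s₁ - ε` holds at EVERY point of
`ℂ²`.  (`t₀ = 1-η`, `t₁ = ½-η`, `s₀ = 1+η`, `s₁ = ½+η`, `u = 1+2η`, `η = min(ε,½)/13`.)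
[cite: Roy2001, Thm. 1; folklore (Dirichlet)] -/
theorem roy_criterion_sharp_in_translate_exponent (ε : ℝ) (hε : 0 < ε) :
    ∃ s₀ s₁ t₀ t₁ u : ℝ, RoyAdmissible s₀ s₁ t₀ t₁ u ∧
      (∀ y α : ℂ, α ≠ 0 → (RoyConditionB y α s₀ s₁ t₀ t₁ u ↔ RoyConditionA y α)) ∧
      ∀ y α : ℂ, RoyConditionB y α s₀ (s₁ - ε) t₀ t₁ u := by
  set ε' : ℝ := min ε (1 / 2) with hε'
  have hε'0 : 0 < ε' := lt_min hε (by norm_num)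
  have hε'1 : ε' ≤ 1 / 2 := min_le_right _ _
  have hε'ε : ε' ≤ ε := min_le_left _ _
  set η : ℝ := ε' / 13 with hη
  have hη0 : 0 < η := by rw [hη]; positivity
  have hη13 : 13 * η = ε' := by rw [hη]; ring
  refine ⟨1 + η, 1 / 2 + η, 1 - η, 1 / 2 - η, 1 + 2 * η, ?_, ?_, ?_⟩
  · refine royAdmissible_iff.mpr ⟨⟨?_, ?_, ?_, ?_, ?_⟩, ⟨?_, ?_, ?_, ?_, ?_, ?_⟩, ⟨?_, ?_, ?_⟩⟩ <;>
      linarith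
  · intro y α hα
    exact (Roy2001_thm1_holds y α hα _ _ _ _ _ (royAdmissible_iff.mpr
      ⟨⟨by linarith, by linarith, by linarith, by linarith, by linarith⟩,
        ⟨by linarith, by linarith, by linarith, by linarith, by linarith, by linarith⟩,
        ⟨by linarith, by linarith, by linarith⟩⟩)).symm
  · intro y α
    refine royConditionB_mono y α (show 1 / 2 + η - ε ≤ 1 / 2 + η - ε' by linarith) ?_
    exact royConditionB_of_lt y α (by linarith) (by linarith) (by linarith) (by linarith)
      (by linarith) (by linarith) (by linarith) (by linarith) (by linarith)

end Summit.Schanuel.Schanuel.Theorems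

end
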